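import Literature.AlgebraicGeometry.HodgeTheory.AlgebraicMonodromyMumfordTate
import Literature.AlgebraicGeometry.Motives.BaseChange
import HarnessLib

/-!
# Hodge-generic `ℚ̄`-points are analytically dense (Baldi–Binyamini–Urbanik 2026, Thm. 1.3 — named fact)

Family `hodge`, layer `Literature/AlgebraicGeometry/HodgeTheory` [topic AlgebraicGeometry/HodgeTheory].
Written by the `hodge-nonav` literature seat for the routes `HodgeConjecture/DworkReflectionQuotients`,
`HodgeConjecture/CyclicUnitaryPowers`, `HodgeConjecture/SignSymmetricPowers` (cell memo ROUTE-P3v12-g14 §3,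
tribunal T2 factual 2026-08-26): each of them proves the Hodge conjecture for (powers of) every
HODGE-GENERIC member of a family defined over `ℚ̄`; with the fact below this yields the conjecture for the
members over an analytically dense set of `ℚ̄`-parameters ("explicit arithmetic members"), as a support
corollary and not as a new crux.

## Source, verbatim

G. Baldi, G. Binyamini, D. Urbanik, *Algebraic Hodge generic points are dense*, arXiv:2606.08882
(v1 7 June 2026, v2 2 July 2026; TeX of both versions held by the cell, the statement and its proof are
identical in v1 and v2) [BaldiBinyaminiUrbanik2026]:

* §1.2 (p. 3): "A point `s ∈ S(ℂ)` is said to be Hodge generic for `(S, 𝕍)` if its Mumford-Tate group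
  is “as big as possible”, i.e., if `𝐆_s = 𝐆`" (`𝐆 = MT(𝕍)` the generic Mumford–Tate group,
  `𝐆_s = MT(𝕍_s)`).
* **Theorem 1.3.** "Let `f : X → S` be a quasi-projective family defined over a number field `K`. Fix an
  integer `j ≥ 0`, and set `𝕍 = R^j f_* ℤ` to be the associated graded polarizable `ℤ`VHS (see §6.1).
  Then the locus of Hodge generic points in `S(ℚ̄)` for `𝕍` is analytically dense in `S(ℂ)`. Put
  differently, the locus of points in `S(ℚ̄)` that do not lie in the (tensorial) Hodge locus of `𝕍` is
  analytically dense in `S(ℂ)`."  (§6.2, standing assumption: "`S` a smooth and geometrically connected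
  `K`-variety"; Thm. 6.4 there is the stronger form with the degree `[κ(s) : K]` bounded, Thm. 6.6 the
  natural-density-one form over `S ⊂ ℙ¹`.)
* The proof (§6.2, from the `G`-function Theorem 4.1 (1)/(3) via the Bombieri–André height bound and
  the finiteness of families of Noether–Lefschetz-type subvarieties of the period domain, §5.3) does NOT
  use Lemma 6.10 of the paper (checked by the cell, STATUS hodge-nonav 2026-08-27 R65); it is a theorem
  of the paper, not a conjecture.

## Rendering (real carriers of the tree; no hypothesis structure)

The tree's `ℚ̄`-anchored setting of `HodgeTheory/HodgeGenericQbarDescent` (Voisin 2007 Prop. 0.7): an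
embedding `σ : ℚ̄ →+* ℂ`, quasi-projective `ℚ̄`-schemes `𝒳₀`, `S₀` with `S₀` smooth and irreducible
(hence geometrically irreducible: `S₀ ⊗_σ ℂ` is a smooth connected complex variety — the printed
"smooth and geometrically connected"; a `ℚ̄`-family is defined over some number field `K`, and
`S(ℚ̄)`, `S(ℂ)` and Hodge-genericity do not see `K`, so the `ℚ̄`-form below is the printed theorem
applied to any model over a number field), a `ℚ̄`-morphism `f₀ : 𝒳₀ ⟶ S₀` whose complexification
`f = f₀ ⊗_σ ℂ` is a smooth projective family of relative dimension `n` (`Motives.IsSmoothProjectiveFamily`;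
the printed theorem allows any quasi-projective family and the mixed VHS `R^j f_* ℤ` —
-- TODO(general form): quasi-projective (non-smooth, non-proper) families and admissible mixed VHS),
cohomologically locally trivial over `S(ℂ)` (`hU`, as in every consumer of `IsHodgeGenericPoint`), a
cohomological degree `k` (the printed `j`), and Hodge-symmetric Hodge models `A t` of the fibres in which
the Hodge structures on `Hᵏ(X_t(ℂ); ℚ)` are read (`HodgeModel`, `IsHodgeSymmetric`; any two give the
same Hodge structure).

* "`s ∈ S(ℚ̄)`" — a complex point `P` of `S = S₀ ⊗_σ ℂ` whose underlying point of `S₀` (under the first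
  projection `baseChangeHomFst σ S₀ : S ⟶ S₀`) is a CLOSED point: `S₀` being of finite type over the
  algebraically closed field `ℚ̄`, its closed points are exactly its `ℚ̄`-rational points
  (Nullstellensatz), and a complex point of `S₀ ⊗_σ ℂ` lies over a closed point `x` iff it is the base
  change along `σ` of the `ℚ̄`-point `x` (the residue field `κ(x) = ℚ̄` maps to `ℂ` by `σ`); over a
  non-closed point `κ(x) ⊋ ℚ̄` is transcendental and the point is not defined over `ℚ̄`.
* "Hodge generic for `𝕍 = Rᵏ f_* ℤ`" — the tree's `IsHodgeGenericPoint f k hU hf A hA s`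
  (`HodgeTheory/AlgebraicMonodromyMumfordTate`: every weight-`0` rational Hodge tensor at `s` stays a
  Hodge tensor under rational parallel transport to every point along every path; CMSP Def. 15.3.5 /
  André's `X̊`), i.e. `MT(𝕍_s)` is the generic Mumford–Tate group — the printed "`𝐆_s = 𝐆`", "not in the
  tensorial Hodge locus" (for a Hodge structure of non-zero weight the Mumford–Tate group contains the
  homotheties and is cut out by its invariants in the weight-`0` tensor spaces `T^{a,a}`, so genericity
  for weight-`0` tensors is genericity for all Hodge tensors).
* "analytically dense in `S(ℂ)`" — `Dense` in `ComplexPoints S` with its analytic (strong) topology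
  (`Motives.AlgPoints.instTopologicalSpace`; Serre GAGA §2).

NAMED FACT (one printed theorem; `Prop`-valued definition, no `sorry`):
`bbu2026_hodgeGenericQbarPoints_dense`. PROVED: the consumer shape `….exists_isHodgeGenericPoint`
(a non-empty base has a Hodge-generic `ℚ̄`-point).

What is NOT here: Thm. 6.4 (bounded field degree), Thm. 6.6 / Cor. 6.7 (natural density one of the
Hodge-generic integers `t` on `S ⊂ ℙ¹`, effective version), Thm. 1.1/1.2 (the motivic loci; their Hodge
and Tate components rest on the paper's Lemma 6.10, whose printed proof covers only the tensors generated
by the polarisation for even-dimensional hypersurfaces — cell reading note, not used here), the mixed /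
quasi-projective generality.

## References

* [BaldiBinyaminiUrbanik2026] G. Baldi, G. Binyamini, D. Urbanik, Algebraic Hodge generic points are
  dense, arXiv:2606.08882 (2026), Thm. 1.3 (§1.2), Thm. 6.4 and §6.2 (proof).
* [CarlsonMullerStachPeters2017] J. Carlson, S. Müller-Stach, C. Peters, Period Mappings and Period
  Domains, 2nd ed. (2017), §15.3 Def. 15.3.5 (Hodge-generic points).
* [Voisin2007HodgeLoci] C. Voisin, Hodge loci and absolute Hodge classes, Compositio Math. 143 (2007)
  (the `ℚ̄`-anchored setting of `HodgeGenericQbarDescent`).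
-/

noncomputable section

open CategoryTheory AlgebraicGeometry
open _root_.Topology
open Literature.AlgebraicTopology.SingularHomology Literature.Geometry.Kaehler
open Literature.AlgebraicGeometry.Motives

namespace Literature.AlgebraicGeometry.HodgeTheory

section HodgeTheory

/-- **Hodge-generic `ℚ̄`-points of a `ℚ̄`-family are analytically dense** (Baldi–Binyamini–Urbanik
2026, Thm. 1.3; named fact). Printed: "Let `f : X → S` be a quasi-projective family defined over a
number field `K`. Fix an integer `j ≥ 0`, and set `𝕍 = R^j f_* ℤ` […]. Then the locus of Hodge generic
points in `S(ℚ̄)` for `𝕍` is analytically dense in `S(ℂ)`. Put differently, the locus of points in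
`S(ℚ̄)` that do not lie in the (tensorial) Hodge locus of `𝕍` is analytically dense in `S(ℂ)`" (with
`S` smooth and geometrically connected, §6.2). On the tree's carriers, for the smooth projective case:
for every embedding `σ : ℚ̄ →+* ℂ`, every `ℚ̄`-morphism `f₀ : 𝒳₀ ⟶ S₀` of quasi-projective `ℚ̄`-schemes
with `S₀` smooth and irreducible whose complexification `f = f₀ ⊗_σ ℂ : 𝒳 ⟶ S` is a smooth projective
family of relative dimension `n`, cohomologically locally trivial over `S(ℂ)` (`hU`), every degree `k`
and Hodge-symmetric Hodge models `A t` of the fibres, the set of complex points `P ∈ S(ℂ)` which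
(i) lie over a CLOSED point of `S₀` (i.e. `P ∈ S(ℚ̄)`: closed points of the finite-type `ℚ̄`-scheme `S₀`
are its `ℚ̄`-points) and (ii) are Hodge generic for `Rᵏ f_* ℚ` (`IsHodgeGenericPoint`: `MT` at `P` is
the generic Mumford–Tate group) is dense in `S(ℂ)` for the analytic topology.
-- TODO(general form): quasi-projective families / admissible graded-polarizable mixed VHS; Thm. 6.4
-- (bounded degree `[κ(s) : K] ≤ d`); Thm. 6.6 (density one of Hodge-generic integers on `S ⊂ ℙ¹`).
[cite: BaldiBinyaminiUrbanik2026, Thm. 1.3 (§1.2, p. 3) and §6.2 Thm. 6.4 (proof)]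
[cite: CarlsonMullerStachPeters2017, Definition 15.3.5] -/
def bbu2026_hodgeGenericQbarPoints_dense : Prop :=
  ∀ [HodgeTensorFacts.{0, 0}] (σ : AlgebraicClosure ℚ →+* ℂ) ⦃𝒳₀ S₀ : SchemeOver (AlgebraicClosure ℚ)⦄
    (f₀ : 𝒳₀ ⟶ S₀) (n k : ℕ), IsQuasiProjectiveOver 𝒳₀ → IsQuasiProjectiveOver S₀ →
    IrreducibleSpace S₀.left → AlgebraicGeometry.Smooth S₀.hom →
    ∀ (hf : IsSmoothProjectiveFamily ((baseChangeHom σ).map f₀) n)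
      (hU : IsCohomologicallyLocallyTrivialOn ((baseChangeHom σ).map f₀)
        (Set.univ : Set (ComplexPoints ((baseChangeHom σ).obj S₀))))
      (A : ∀ t : ComplexPoints ((baseChangeHom σ).obj S₀),
        HodgeModel n (fiberOver ((baseChangeHom σ).map f₀) t))
      (hA : ∀ t, (A t).IsHodgeSymmetric)
      [∀ t : ComplexPoints ((baseChangeHom σ).obj S₀), Module.Finite ℚ
        (singularCohomology ℚ ℚ (ComplexPoints (fiberOver ((baseChangeHom σ).map f₀) t)) k)],
      Dense {P : ComplexPoints ((baseChangeHom σ).obj S₀) |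
        IsClosed ({(baseChangeHomFst σ S₀).base P.pt} : Set S₀.left) ∧
          IsHodgeGenericPoint ((baseChangeHom σ).map f₀) k hU hf A hA ⟨P, Set.mem_univ P⟩}

/-- **Consumer shape: a `ℚ̄`-family over a base with a complex point has a Hodge-generic `ℚ̄`-point**
(immediate from density: a dense subset of a non-empty space is non-empty).
[cite: BaldiBinyaminiUrbanik2026, Thm. 1.3] -/
theorem bbu2026_hodgeGenericQbarPoints_dense.exists_isHodgeGenericPoint
    (h : bbu2026_hodgeGenericQbarPoints_dense) [HodgeTensorFacts.{0, 0}]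
    (σ : AlgebraicClosure ℚ →+* ℂ) {𝒳₀ S₀ : SchemeOver (AlgebraicClosure ℚ)} (f₀ : 𝒳₀ ⟶ S₀) {n : ℕ}
    (k : ℕ) (h𝒳₀ : IsQuasiProjectiveOver 𝒳₀) (hS₀ : IsQuasiProjectiveOver S₀)
    (hirr : IrreducibleSpace S₀.left) (hsm : AlgebraicGeometry.Smooth S₀.hom)
    (hf : IsSmoothProjectiveFamily ((baseChangeHom σ).map f₀) n)
    (hU : IsCohomologicallyLocallyTrivialOn ((baseChangeHom σ).map f₀)
      (Set.univ : Set (ComplexPoints ((baseChangeHom σ).obj S₀))))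
    (A : ∀ t : ComplexPoints ((baseChangeHom σ).obj S₀),
      HodgeModel n (fiberOver ((baseChangeHom σ).map f₀) t))
    (hA : ∀ t, (A t).IsHodgeSymmetric)
    [∀ t : ComplexPoints ((baseChangeHom σ).obj S₀), Module.Finite ℚ
      (singularCohomology ℚ ℚ (ComplexPoints (fiberOver ((baseChangeHom σ).map f₀) t)) k)]
    [Nonempty (ComplexPoints ((baseChangeHom σ).obj S₀))] :
    ∃ P : ComplexPoints ((baseChangeHom σ).obj S₀),
      IsClosed ({(baseChangeHomFst σ S₀).base P.pt} : Set S₀.left) ∧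
        IsHodgeGenericPoint ((baseChangeHom σ).map f₀) k hU hf A hA ⟨P, Set.mem_univ P⟩ := by
  obtain ⟨P, hP⟩ := (h σ f₀ n k h𝒳₀ hS₀ hirr hsm hf hU A hA).nonempty
  exact ⟨P, hP⟩

end HodgeTheory

end Literature.AlgebraicGeometry.HodgeTheory

end
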